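import Summits.QuantumAdvantage.QuantumAdvantage.Theorems.SosSandwichPseudoBoundedAAClassicalCornerLevelOnePath
import Literature.Computability.Complexity.FourierTails
import HarnessLib

/-!
# Crux `PseudoBoundedAA` (stmt-QuantumAdvantage-15237, route SosSandwich) — the classical corner `R_T`:
# O'Donnell–Servedio for mixtures, `L_{1,1}(p) ≤ √C̄`, and the LINEAR-in-`T` law `4 · W¹[p]² ≤ C̄ · maxⱼ Infⱼ[p]`
# for the level-one part of the variance

Support file for the rank-2 crux PB-AA (`Theses/SosSandwich.lean`, item stmt-QuantumAdvantage-15237).  On the classical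
corner `R_T ⊆ K_T` (acceptance probabilities `p = Σ_k w_k·[t_k accepts]` of randomized classical query algorithms, `w_k ≥ 0`,
`Σ w_k ≤ 1`) the tree holds the law `16·Var[p]² ≤ D̄²·maxⱼ Infⱼ[p]` (`ClassicalCorner.exists_influence_ge_of_mixture_sq`,
exponent `2` in the number of queries) and the leaf-martingale law `16·Var² ≤ D̄·E_x maxⱼ (p − pʲ)²` with ONE factor `D̄` but the
maximum over coordinates inside the expectation (`ClassicalCornerQuadratic`).  Whether exponent `1` holds with the maximum
OUTSIDE (`Var² ≲ T · maxⱼ Infⱼ`) was left open by the previous hands (repair census 2026-09-01, item 4).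

This file answers it for the LEVEL-ONE part of the variance.  With the per-tree O'Donnell–Servedio bound of
`SosSandwichPseudoBoundedAAClassicalCornerLevelOnePath` (`sum_mul_linForm_le_sqrt_cost`):

* `cubeFourierCoeff_singleton`, `l1Level_one_eq`, `levelWeight_one_eq`, `tailWeight_one_eq_levelWeight_add` — level-one
  bookkeeping in the tree's cube Fourier conventions (`LowDegree.cubeFourierCoeff`, `l1Level`, `levelWeight`, `tailWeight`);
* `abs_cubeFourierCoeff_singleton_le` — `|p̂({i})| ≤ ½ √Infᵢ[p]`;
* **`l1Level_one_le_sqrt_avgCost`**, `l1Level_one_le_sqrt_avgDepth` — O'Donnell–Servedio for MIXTURES of decision trees: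
  `L_{1,1}(p) = Σᵢ |p̂({i})| ≤ √C̄ ≤ √D̄`, `C̄ = Σ_k w_k · E_x cost_{t_k}(x)` (expected number of queries), `D̄ = Σ_k w_k · depth(t_k)`;
* **`exists_four_levelWeight_sq_le_avgCost_mul`**, `…_le_avgDepth_mul`, `…_le_depth_mul` — for some `j`,
  `4 · W¹[p]² ≤ C̄ · Infⱼ[p] ≤ D̄ · Infⱼ[p] ≤ T · Infⱼ[p]`: the level-one Fourier weight of a classical acceptance probability
  obeys the influence law with the sharp exponent `2` in the weight (equality shape at `T = 1`: one uniformly random query,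
  `W¹ = Var = 1/(4N)`, `Inf = 1/N²`, `C̄ = 1`) and exponent ONE in the number of queries;
* `exists_sixteen_variance_sq_le` — consequence for the full variance (`Var = W¹ + W^{≥2}`):
  `16·Var[p]² ≤ 8·C̄·Infⱼ[p] + 32·(W^{≥2}[p])²`; so a family in `R_T` on which `Var²/(T·maxInf)` is unbounded — separating the
  `T`-exponents `1` and `2` of the full law — must carry asymptotically all of its variance at Fourier levels `≥ 2`.

Honest label: a published inequality (O'Donnell–Servedio 2007; O'Donnell 2014 §8.6 "OS Inequality") ported to the tree's
decision-tree mixtures, plus elementary corollaries calibrating the classical corner of an open conjecture; no stub, crux or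
summit is closed.
-/

set_option linter.dupNamespace false

noncomputable section

namespace Summit.QuantumAdvantage.QuantumAdvantage.Theorems.SosSandwich

open Finset Function
open Literature.Computability.Complexity Literature.Computability.QuantumComplexity
open Literature.Probability.RandomGraphs.LowDegree (sgn sgn_true sgn_false walsh)

namespace ClassicalCornerLevelOne

variable {N : ℕ}

/-! ### Level-one Fourier coefficients in the tree's conventions -/

/-- `p̂({i}) = 2^{-N} Σₓ p(x) χᵢ(x)`. [cite: ODonnell2014, §1.2] -/
theorem cubeFourierCoeff_singleton (P : (Fin N → Bool) → ℝ) (i : Fin N) :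
    LowDegree.cubeFourierCoeff P {i} = (∑ x, P x * sgn (x i)) / (2 : ℝ) ^ N := by
  unfold LowDegree.cubeFourierCoeff
  simp [walsh]

/-- `L_{1,1}(p) = Σᵢ |p̂({i})|`. [cite: Tal2017, Definition 2.7] -/
theorem l1Level_one_eq (P : (Fin N → Bool) → ℝ) :
    LowDegree.l1Level P 1 = ∑ i : Fin N, |LowDegree.cubeFourierCoeff P {i}| := by
  unfold LowDegree.l1Level
  rw [Finset.powersetCard_one, Finset.sum_map]
  rfl

/-- `W¹[p] = Σᵢ p̂({i})²`. [cite: Tal2017, §2.2] -/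
theorem levelWeight_one_eq (P : (Fin N → Bool) → ℝ) :
    LowDegree.levelWeight P 1 = ∑ i : Fin N, LowDegree.cubeFourierCoeff P {i} ^ 2 := by
  unfold LowDegree.levelWeight
  rw [Finset.powersetCard_one, Finset.sum_map]
  rfl

/-- `W^{≥1}[p] = W¹[p] + W^{≥2}[p]`. [cite: Tal2017, §2.2] -/
theorem tailWeight_one_eq_levelWeight_add (P : (Fin N → Bool) → ℝ) :
    LowDegree.tailWeight P 1 = LowDegree.levelWeight P 1 + LowDegree.tailWeight P 2 := by
  classical
  unfold LowDegree.tailWeight LowDegree.levelWeight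
  rw [Finset.powersetCard_eq_filter]
  have hsplit := (Finset.sum_filter_add_sum_filter_not
    (Finset.univ.filter (fun S : Finset (Fin N) => 1 ≤ S.card)) (fun S : Finset (Fin N) => S.card = 1)
    (fun S => LowDegree.cubeFourierCoeff P S ^ 2)).symm
  rw [Finset.filter_filter, Finset.filter_filter] at hsplit
  rw [hsplit]
  congr 1
  · refine Finset.sum_congr ?_ fun _ _ => rfl
    ext S
    simp only [Finset.mem_filter, Finset.mem_univ, true_and, Finset.mem_powerset, Finset.subset_univ]
    omega
  · refine Finset.sum_congr ?_ fun _ _ => rfl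
    ext S
    simp only [Finset.mem_filter, Finset.mem_univ, true_and]
    omega

/-- **`|p̂({i})| ≤ ½ √Infᵢ[p]`**: pairing `x` with `xⁱ`, `Σₓ p χᵢ = ½ Σₓ (p(x^{i→0}) − p(x^{i→1}))`, then Cauchy–Schwarz
(`ClassicalCorner.sum_abs_update_le_sqrt_influence`). [cite: ODonnell2014, §2.2] -/
theorem abs_cubeFourierCoeff_singleton_le (p : MvPolynomial (Fin N) ℝ) (i : Fin N) :
    |LowDegree.cubeFourierCoeff (evalBool p) {i}| ≤ Real.sqrt (influence i p) / 2 := by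
  have h2N : (0 : ℝ) < (2 : ℝ) ^ N := by positivity
  -- `Σₓ p χᵢ = ½ Σₓ (p(x^{i→0}) − p(x^{i→1}))`
  have hhalf : ∑ x, evalBool p x * sgn (x i)
      = (∑ x, (evalBool p (update x i false) - evalBool p (update x i true))) / 2 := by
    rw [BooleanCorner.sum_eq_half_sum_update i (fun x => evalBool p x * sgn (x i)), Finset.sum_sub_distrib]
    simp only [update_self, sgn_true, sgn_false, mul_neg, mul_one, Finset.sum_neg_distrib]
    ring
  have htri : |∑ x, (evalBool p (update x i false) - evalBool p (update x i true))|
      ≤ (2 : ℝ) ^ N * Real.sqrt (influence i p) :=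
    calc |∑ x, (evalBool p (update x i false) - evalBool p (update x i true))|
        ≤ ∑ x, |evalBool p (update x i false) - evalBool p (update x i true)| := Finset.abs_sum_le_sum_abs _ _
      _ = ∑ x, |evalBool p (update x i true) - evalBool p (update x i false)| :=
          Finset.sum_congr rfl fun x _ => abs_sub_comm _ _
      _ ≤ (2 : ℝ) ^ N * Real.sqrt (influence i p) := ClassicalCorner.sum_abs_update_le_sqrt_influence p i
  rw [cubeFourierCoeff_singleton, hhalf, abs_div, abs_div, abs_two, abs_of_pos h2N]
  calc |∑ x, (evalBool p (update x i false) - evalBool p (update x i true))| / 2 / (2 : ℝ) ^ N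
      ≤ (2 : ℝ) ^ N * Real.sqrt (influence i p) / 2 / (2 : ℝ) ^ N := by gcongr
    _ = Real.sqrt (influence i p) / 2 := by
        field_simp

/-! ### O'Donnell–Servedio for mixtures: `L_{1,1}(p) ≤ √(expected cost)` -/

/-- **O'Donnell–Servedio inequality for randomized classical query algorithms.**  If `P(x) = Σ_{k∈s} w_k·[t_k accepts x]` with
`w_k ≥ 0`, `Σ w_k ≤ 1`, then `Σᵢ |P̂({i})| ≤ √C̄` with `C̄ = Σ_k w_k · (2^{-N} Σₓ cost_{t_k}(x))` the expected number of queries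
on a uniformly random input.  Per tree this is `sum_mul_linForm_le_sqrt_cost` with the signs of the coefficients; the trees
are combined by the weighted Cauchy–Schwarz inequality `Σ w_k √a_k ≤ √(Σ w_k) · √(Σ w_k a_k)`.
[cite: ODonnellServedio2007, §3] [cite: ODonnell2014, §8.6 (OS Inequality)] -/
theorem l1Level_one_le_sqrt_avgCost {ι : Type*} (s : Finset ι) (w : ι → ℝ) (hw : ∀ k ∈ s, 0 ≤ w k)
    (hw1 : ∑ k ∈ s, w k ≤ 1) (t : ι → DecisionTree N) (P : (Fin N → Bool) → ℝ)
    (hP : ∀ x, P x = ∑ k ∈ s, w k * (if (t k).eval x = true then (1 : ℝ) else 0)) :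
    LowDegree.l1Level P 1 ≤ Real.sqrt (∑ k ∈ s, w k * ((∑ x, ((t k).cost x : ℝ)) / (2 : ℝ) ^ N)) := by
  have h2N : (0 : ℝ) < (2 : ℝ) ^ N := by positivity
  -- signs of the level-one coefficients
  obtain ⟨σ, hσdef⟩ : ∃ σ : Fin N → ℝ, ∀ i, σ i = if 0 ≤ LowDegree.cubeFourierCoeff P {i} then 1 else -1 :=
    ⟨_, fun i => rfl⟩
  have hσ : ∀ i, |σ i| ≤ 1 := by
    intro i
    rw [hσdef i]
    split_ifs <;> simp
  have habs : ∀ i, |LowDegree.cubeFourierCoeff P {i}| = σ i * LowDegree.cubeFourierCoeff P {i} := by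
    intro i
    rw [hσdef i]
    split_ifs with h
    · rw [abs_of_nonneg h, one_mul]
    · rw [abs_of_neg (lt_of_not_ge h)]
      ring
  rw [l1Level_one_eq, Finset.sum_congr rfl fun i _ => habs i]
  simp only [cubeFourierCoeff_singleton]
  -- `Σᵢ σᵢ · (Σₓ P χᵢ)/2^N = (Σₓ P · Σᵢ σᵢ χᵢ)/2^N`
  have hswap : ∑ i, σ i * ((∑ x, P x * sgn (x i)) / (2 : ℝ) ^ N)
      = (∑ x, P x * ∑ i, σ i * sgn (x i)) / (2 : ℝ) ^ N := by
    have h1 : ∀ i : Fin N, σ i * ((∑ x, P x * sgn (x i)) / (2 : ℝ) ^ N)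
        = (∑ x : Fin N → Bool, σ i * (P x * sgn (x i))) / (2 : ℝ) ^ N := fun i => by
      rw [mul_div_assoc', Finset.mul_sum]
    rw [Finset.sum_congr rfl fun i _ => h1 i, ← Finset.sum_div, Finset.sum_comm]
    congr 1
    refine Finset.sum_congr rfl fun x _ => ?_
    rw [Finset.mul_sum]
    exact Finset.sum_congr rfl fun i _ => by ring
  rw [hswap]
  -- linearity in the mixture
  obtain ⟨Fk, hFk⟩ : ∃ Fk : ι → (Fin N → Bool) → ℝ, ∀ k x,
      Fk k x = if (t k).eval x = true then (1 : ℝ) else 0 := ⟨_, fun k x => rfl⟩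
  have hP' : ∀ x, P x = ∑ k ∈ s, w k * Fk k x := fun x => by
    rw [hP x]
    exact Finset.sum_congr rfl fun k _ => by rw [hFk k x]
  have hlin : ∑ x, P x * ∑ i, σ i * sgn (x i) = ∑ k ∈ s, w k * ∑ x, Fk k x * ∑ i, σ i * sgn (x i) := by
    calc ∑ x, P x * ∑ i, σ i * sgn (x i) = ∑ x, ∑ k ∈ s, w k * (Fk k x * ∑ i, σ i * sgn (x i)) := by
          refine Finset.sum_congr rfl fun x _ => ?_
          rw [hP' x, Finset.sum_mul]
          exact Finset.sum_congr rfl fun k _ => by ring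
      _ = ∑ k ∈ s, ∑ x, w k * (Fk k x * ∑ i, σ i * sgn (x i)) := Finset.sum_comm
      _ = ∑ k ∈ s, w k * ∑ x, Fk k x * ∑ i, σ i * sgn (x i) :=
          Finset.sum_congr rfl fun k _ => by rw [Finset.mul_sum]
  have hk : ∀ k ∈ s, ∑ x, Fk k x * ∑ i, σ i * sgn (x i) ≤ Real.sqrt ((2 : ℝ) ^ N * ∑ x, ((t k).cost x : ℝ)) :=
    fun k _ => sum_mul_linForm_le_sqrt_cost (t k) σ hσ (Fk k) (hFk k)
  have h1 : ∑ x, P x * ∑ i, σ i * sgn (x i)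
      ≤ ∑ k ∈ s, w k * Real.sqrt ((2 : ℝ) ^ N * ∑ x, ((t k).cost x : ℝ)) := by
    rw [hlin]
    exact Finset.sum_le_sum fun k hk' => mul_le_mul_of_nonneg_left (hk k hk') (hw k hk')
  have h2 := ClassicalCornerQuadratic.sum_mul_sqrt_le s w (fun k => (2 : ℝ) ^ N * ∑ x, ((t k).cost x : ℝ)) hw
    (fun k _ => mul_nonneg h2N.le (Finset.sum_nonneg fun x _ => Nat.cast_nonneg _))
  have h3 : Real.sqrt (∑ k ∈ s, w k) ≤ 1 := by
    rw [← Real.sqrt_one]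
    exact Real.sqrt_le_sqrt hw1
  have hB : 0 ≤ Real.sqrt (∑ k ∈ s, w k * ((2 : ℝ) ^ N * ∑ x, ((t k).cost x : ℝ))) := Real.sqrt_nonneg _
  have h4 : ∑ x, P x * ∑ i, σ i * sgn (x i)
      ≤ Real.sqrt (∑ k ∈ s, w k * ((2 : ℝ) ^ N * ∑ x, ((t k).cost x : ℝ))) := by
    calc _ ≤ _ := h1
      _ ≤ _ := h2
      _ ≤ 1 * Real.sqrt (∑ k ∈ s, w k * ((2 : ℝ) ^ N * ∑ x, ((t k).cost x : ℝ))) :=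
          mul_le_mul_of_nonneg_right h3 hB
      _ = _ := one_mul _
  -- divide by `2^N`: `√(Σ w_k · 2^N C_k) / 2^N = √(Σ w_k · C_k/2^N)`
  have hsum_eq : ∑ k ∈ s, w k * ((2 : ℝ) ^ N * ∑ x, ((t k).cost x : ℝ))
      = ((2 : ℝ) ^ N) ^ 2 * ∑ k ∈ s, w k * ((∑ x, ((t k).cost x : ℝ)) / (2 : ℝ) ^ N) := by
    rw [Finset.mul_sum]
    refine Finset.sum_congr rfl fun k _ => ?_
    rw [div_eq_mul_inv]
    have hinv : (2 : ℝ) ^ N * ((2 : ℝ) ^ N)⁻¹ = 1 := mul_inv_cancel₀ h2N.ne'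
    linear_combination (-(w k * (2 : ℝ) ^ N * ∑ x, ((t k).cost x : ℝ))) * hinv
  have h5 : (∑ x, P x * ∑ i, σ i * sgn (x i)) / (2 : ℝ) ^ N
      ≤ Real.sqrt (∑ k ∈ s, w k * ((2 : ℝ) ^ N * ∑ x, ((t k).cost x : ℝ))) / (2 : ℝ) ^ N :=
    div_le_div_of_nonneg_right h4 h2N.le
  rw [hsum_eq, Real.sqrt_mul (pow_nonneg h2N.le 2), Real.sqrt_sq h2N.le, mul_div_cancel_left₀ _ h2N.ne'] at h5
  exact h5

/-- Depth form: `Σᵢ |P̂({i})| ≤ √D̄`, `D̄ = Σ_k w_k · depth(t_k)` (`cost ≤ depth` pointwise).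
[cite: ODonnellServedio2007, §3] [cite: ODonnell2014, §8.6 (OS Inequality)] -/
theorem l1Level_one_le_sqrt_avgDepth {ι : Type*} (s : Finset ι) (w : ι → ℝ) (hw : ∀ k ∈ s, 0 ≤ w k)
    (hw1 : ∑ k ∈ s, w k ≤ 1) (t : ι → DecisionTree N) (P : (Fin N → Bool) → ℝ)
    (hP : ∀ x, P x = ∑ k ∈ s, w k * (if (t k).eval x = true then (1 : ℝ) else 0)) :
    LowDegree.l1Level P 1 ≤ Real.sqrt (∑ k ∈ s, w k * ((t k).depth : ℝ)) := by
  refine (l1Level_one_le_sqrt_avgCost s w hw hw1 t P hP).trans (Real.sqrt_le_sqrt ?_)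
  refine Finset.sum_le_sum fun k hk => mul_le_mul_of_nonneg_left ?_ (hw k hk)
  have h2N : (0 : ℝ) < (2 : ℝ) ^ N := by positivity
  rw [div_le_iff₀ h2N]
  calc ∑ x, ((t k).cost x : ℝ) ≤ ∑ _x : Fin N → Bool, ((t k).depth : ℝ) :=
        Finset.sum_le_sum fun x _ => by exact_mod_cast (t k).cost_le_depth x
    _ = ((t k).depth : ℝ) * (2 : ℝ) ^ N := by
        rw [Finset.sum_const, Finset.card_univ, BooleanCorner.card_cube_nat, nsmul_eq_mul]
        push_cast
        ring

/-! ### The level-one influence law with exponent ONE in the number of queries -/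

/-- **`4 · W¹[p]² ≤ C̄ · maxⱼ Infⱼ[p]` on the classical corner.**  If the real polynomial `p` takes on the cube the values of a
mixture of decision trees (`w_k ≥ 0`, `Σ w_k ≤ 1`) and its level-one Fourier weight is positive, then for the variable `j` of
largest influence `4 · W¹[p]² ≤ C̄ · Infⱼ[p]`, `C̄ = Σ_k w_k · E_x cost_{t_k}(x)`: `W¹ = Σᵢ p̂(i)² ≤ maxᵢ |p̂(i)| · Σᵢ |p̂(i)|
≤ ½√Infⱼ · √C̄`.  Exponent `2` in the weight and exponent ONE in the number of queries — compare the tree's full law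
`16·Var² ≤ D̄²·maxInf` (`ClassicalCorner.exists_influence_ge_of_mixture_sq`).
[cite: ODonnellServedio2007, §3] [cite: AaronsonAmbainis2014, Thm 8 and the remark following it] -/
theorem exists_four_levelWeight_sq_le_avgCost_mul {ι : Type*} (s : Finset ι) (w : ι → ℝ) (hw : ∀ k ∈ s, 0 ≤ w k)
    (hw1 : ∑ k ∈ s, w k ≤ 1) (t : ι → DecisionTree N) (p : MvPolynomial (Fin N) ℝ)
    (hp : ∀ x, evalBool p x = ∑ k ∈ s, w k * (if (t k).eval x = true then (1 : ℝ) else 0))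
    (hW : 0 < LowDegree.levelWeight (evalBool p) 1) :
    ∃ j : Fin N, 4 * LowDegree.levelWeight (evalBool p) 1 ^ 2
      ≤ (∑ k ∈ s, w k * ((∑ x, ((t k).cost x : ℝ)) / (2 : ℝ) ^ N)) * influence j p := by
  classical
  rcases Nat.eq_zero_or_pos N with hN0 | hNpos
  · subst hN0
    exfalso
    rw [levelWeight_one_eq] at hW
    simp at hW
  have hne : (Finset.univ : Finset (Fin N)).Nonempty := ⟨⟨0, hNpos⟩, Finset.mem_univ _⟩
  obtain ⟨j, -, hj⟩ := Finset.exists_max_image Finset.univ (fun j => influence j p) hne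
  refine ⟨j, ?_⟩
  obtain ⟨C, hC⟩ : ∃ C : ℝ, C = ∑ k ∈ s, w k * ((∑ x, ((t k).cost x : ℝ)) / (2 : ℝ) ^ N) := ⟨_, rfl⟩
  rw [← hC]
  have h2N : (0 : ℝ) < (2 : ℝ) ^ N := by positivity
  have hC0 : 0 ≤ C := by
    rw [hC]
    exact Finset.sum_nonneg fun k hk =>
      mul_nonneg (hw k hk) (div_nonneg (Finset.sum_nonneg fun x _ => Nat.cast_nonneg _) h2N.le)
  have hIj := influence_nonneg j p
  -- `|p̂(i)| ≤ ½ √Inf_j` for every `i`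
  have hcoef : ∀ i, |LowDegree.cubeFourierCoeff (evalBool p) {i}| ≤ Real.sqrt (influence j p) / 2 := fun i =>
    (abs_cubeFourierCoeff_singleton_le p i).trans
      (div_le_div_of_nonneg_right (Real.sqrt_le_sqrt (hj i (Finset.mem_univ _))) (by norm_num))
  -- `W¹ ≤ ½ √Inf_j · L_{1,1} ≤ ½ √Inf_j · √C`
  have hW1 : LowDegree.levelWeight (evalBool p) 1 ≤ Real.sqrt (influence j p) / 2 * Real.sqrt C := by
    rw [levelWeight_one_eq]
    calc ∑ i, LowDegree.cubeFourierCoeff (evalBool p) {i} ^ 2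
        = ∑ i, |LowDegree.cubeFourierCoeff (evalBool p) {i}| * |LowDegree.cubeFourierCoeff (evalBool p) {i}| :=
          Finset.sum_congr rfl fun i _ => by rw [← sq, sq_abs]
      _ ≤ ∑ i, Real.sqrt (influence j p) / 2 * |LowDegree.cubeFourierCoeff (evalBool p) {i}| :=
          Finset.sum_le_sum fun i _ => mul_le_mul_of_nonneg_right (hcoef i) (abs_nonneg _)
      _ = Real.sqrt (influence j p) / 2 * LowDegree.l1Level (evalBool p) 1 := by
          rw [← Finset.mul_sum, l1Level_one_eq]
      _ ≤ Real.sqrt (influence j p) / 2 * Real.sqrt C := by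
          rw [hC]
          exact mul_le_mul_of_nonneg_left (l1Level_one_le_sqrt_avgCost s w hw hw1 t (evalBool p) hp)
            (by positivity)
  have hW0 : 0 ≤ LowDegree.levelWeight (evalBool p) 1 := hW.le
  calc 4 * LowDegree.levelWeight (evalBool p) 1 ^ 2
      ≤ 4 * (Real.sqrt (influence j p) / 2 * Real.sqrt C) ^ 2 :=
        mul_le_mul_of_nonneg_left (pow_le_pow_left₀ hW0 hW1 2) (by norm_num)
    _ = C * influence j p := by
        rw [mul_pow, div_pow, Real.sq_sqrt hIj, Real.sq_sqrt hC0]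
        ring

/-- Depth form: `4 · W¹[p]² ≤ D̄ · Infⱼ[p]` for some `j`, `D̄ = Σ_k w_k · depth(t_k)`.
[cite: ODonnellServedio2007, §3] [cite: AaronsonAmbainis2014, Thm 8 and the remark following it] -/
theorem exists_four_levelWeight_sq_le_avgDepth_mul {ι : Type*} (s : Finset ι) (w : ι → ℝ) (hw : ∀ k ∈ s, 0 ≤ w k)
    (hw1 : ∑ k ∈ s, w k ≤ 1) (t : ι → DecisionTree N) (p : MvPolynomial (Fin N) ℝ)
    (hp : ∀ x, evalBool p x = ∑ k ∈ s, w k * (if (t k).eval x = true then (1 : ℝ) else 0))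
    (hW : 0 < LowDegree.levelWeight (evalBool p) 1) :
    ∃ j : Fin N, 4 * LowDegree.levelWeight (evalBool p) 1 ^ 2 ≤ (∑ k ∈ s, w k * ((t k).depth : ℝ)) * influence j p := by
  obtain ⟨j, hj⟩ := exists_four_levelWeight_sq_le_avgCost_mul s w hw hw1 t p hp hW
  refine ⟨j, hj.trans (mul_le_mul_of_nonneg_right ?_ (influence_nonneg j p))⟩
  refine Finset.sum_le_sum fun k hk => mul_le_mul_of_nonneg_left ?_ (hw k hk)
  have h2N : (0 : ℝ) < (2 : ℝ) ^ N := by positivity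
  rw [div_le_iff₀ h2N]
  calc ∑ x, ((t k).cost x : ℝ) ≤ ∑ _x : Fin N → Bool, ((t k).depth : ℝ) :=
        Finset.sum_le_sum fun x _ => by exact_mod_cast (t k).cost_le_depth x
    _ = ((t k).depth : ℝ) * (2 : ℝ) ^ N := by
        rw [Finset.sum_const, Finset.card_univ, BooleanCorner.card_cube_nat, nsmul_eq_mul]
        push_cast
        ring

/-- Uniform-depth form: if every tree of the mixture has depth `≤ T` and `Σ w ≤ 1`, then `4 · W¹[p]² ≤ T · Infⱼ[p]` for
some `j` — exponent ONE in `T`. [cite: ODonnellServedio2007, §3] [cite: AaronsonAmbainis2014, Thm 8 and the remark following it] -/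
theorem exists_four_levelWeight_sq_le_depth_mul {ι : Type*} (s : Finset ι) (w : ι → ℝ) (hw : ∀ k ∈ s, 0 ≤ w k)
    (hw1 : ∑ k ∈ s, w k ≤ 1) (t : ι → DecisionTree N) (T : ℕ) (hT : ∀ k ∈ s, (t k).depth ≤ T)
    (p : MvPolynomial (Fin N) ℝ)
    (hp : ∀ x, evalBool p x = ∑ k ∈ s, w k * (if (t k).eval x = true then (1 : ℝ) else 0))
    (hW : 0 < LowDegree.levelWeight (evalBool p) 1) :
    ∃ j : Fin N, 4 * LowDegree.levelWeight (evalBool p) 1 ^ 2 ≤ (T : ℝ) * influence j p := by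
  obtain ⟨j, hj⟩ := exists_four_levelWeight_sq_le_avgDepth_mul s w hw hw1 t p hp hW
  refine ⟨j, hj.trans (mul_le_mul_of_nonneg_right ?_ (influence_nonneg j p))⟩
  calc ∑ k ∈ s, w k * ((t k).depth : ℝ) ≤ ∑ k ∈ s, w k * (T : ℝ) :=
        Finset.sum_le_sum fun k hk => mul_le_mul_of_nonneg_left (by exact_mod_cast hT k hk) (hw k hk)
    _ = (∑ k ∈ s, w k) * T := by rw [Finset.sum_mul]
    _ ≤ 1 * T := by gcongr
    _ = T := one_mul _

/-! ### Consequence for the full variance -/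

/-- **Where a `T`-exponent separation must live.**  With `V = W^{≥1}[p]` (`= Var[p]` by Parseval,
`DFKOInfluenceBoundProofs.boolVariance_eq_tailWeight_one`) and `R = W^{≥2}[p]`: if `W¹[p] > 0` then for some `j`,
`16·V² ≤ 8·C̄·Infⱼ[p] + 32·R²` (`V = W¹ + R`, `(a+b)² ≤ 2a² + 2b²`, and `4·W¹² ≤ C̄·Infⱼ`).  Hence on any family in `R_T` on which
`V²/(C̄ · maxⱼ Infⱼ)` is unbounded, `R/V → 1`: the variance escapes to Fourier levels `≥ 2`.
[cite: ODonnellServedio2007, §3] [cite: AaronsonAmbainis2014, Thm 8 and the remark following it] -/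
theorem exists_sixteen_tailWeight_sq_le {ι : Type*} (s : Finset ι) (w : ι → ℝ) (hw : ∀ k ∈ s, 0 ≤ w k)
    (hw1 : ∑ k ∈ s, w k ≤ 1) (t : ι → DecisionTree N) (p : MvPolynomial (Fin N) ℝ)
    (hp : ∀ x, evalBool p x = ∑ k ∈ s, w k * (if (t k).eval x = true then (1 : ℝ) else 0))
    (hW : 0 < LowDegree.levelWeight (evalBool p) 1) :
    ∃ j : Fin N, 16 * LowDegree.tailWeight (evalBool p) 1 ^ 2
      ≤ 8 * (∑ k ∈ s, w k * ((∑ x, ((t k).cost x : ℝ)) / (2 : ℝ) ^ N)) * influence j p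
        + 32 * LowDegree.tailWeight (evalBool p) 2 ^ 2 := by
  obtain ⟨j, hj⟩ := exists_four_levelWeight_sq_le_avgCost_mul s w hw hw1 t p hp hW
  refine ⟨j, ?_⟩
  rw [tailWeight_one_eq_levelWeight_add]
  nlinarith [sq_nonneg (LowDegree.levelWeight (evalBool p) 1 - LowDegree.tailWeight (evalBool p) 2)]

end ClassicalCornerLevelOne

end Summit.QuantumAdvantage.QuantumAdvantage.Theorems.SosSandwich

end
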